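import Literature.AlgebraicGeometry.AbelianVarieties.InvariantDivisorDescentMulTwo
import Literature.AlgebraicGeometry.AbelianVarieties.NeronSeveriHalfOfTwoTorsion
import Literature.AlgebraicGeometry.AbelianSchemes.IsLambdaOfAtSquareRoot
import Literature.AlgebraicGeometry.AbelianSchemes.AbelianSchemeOverMulNEtale
import Literature.AlgebraicGeometry.AbelianSchemes.AbelianSchemeConstSubgroupQuotientEtale
import Literature.AlgebraicGeometry.AbelianSchemes.AbelianSchemeConstSubgroupQuotientOfField
import Literature.AlgebraicGeometry.RelativeSpec.GeometricQuotientFreeEquivariantDescent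
import HarnessLib

/-!
# The square root of `Λ` in characteristic `≠ 2`: `λ̄² = Λ(ample) ⇒ λ̄ = Λ(ample′)` over an algebraically closed field with `2 ≠ 0`
# ([MumfordAV1970] §23 Thm. 3 at `n = 2`; [GortzWedhorn2023] Prop. 27.284) — organ O5 «HALF-`p`» of the P6 road «Θ-SPREAD»

Layer `Literature/AlgebraicGeometry/AbelianSchemes` (§1–§2 declare in `Literature.AlgebraicGeometry.Motives.AbelianVariety`, §3 in
`Literature.AlgebraicGeometry.AbelianSchemes.AbelianSchemeOver`).  THEOREMS ONLY (no definition, no named fact, no instance, no notation, no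
`sorry`).  Cell `hodgecm-mathlib` (D-0151), FLOOR 0, P6 «MOD programme» (crux hLiu418 = stmt-HodgeConjecture-24832), SPREAD door, item (s2-λ), road
«Θ-SPREAD» (LEAD F0P6-plan (g2) RULING M-28′ (i): «(C1) + O5 HALF-`p` in-house, `2` inverted on the stage — 0 letters»; B-p18 (g38)).  The
`half` binder of ★ `PolarizationSpreadOfGenericPolarization.exists_stage_polarization_of_generic_polarization` (p847137) is THIS file's §3 head.
HC_CM is proved only modulo the printed citations until rung 0 closes; this file is generic and changes no count.

THE POINT.  The tree's square-root chain ★ G1 `TranslationEigenDivisor` → ★ G2 `InvariantDivisorDescentMulTwo` → ★ G3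
`NeronSeveriHalfOfTwoTorsion` → ★ G4 `IsLambdaOfAtSquareRoot` §5 is typed `[CharZero Ω]`, but characteristic `0` enters at ONE step: G2 §3
`isIso_of_comp_eq_pow_two` — the descent `π : A∕A[2] → A` of `[2]` along the free quotient `ψ : A → A∕A[2]` is an isomorphism — was proved by
«bijective + proper onto smooth ⇒ iso» (★ `isIso_of_bijective_of_isProper_of_smooth`), false in characteristic `p` (Frobenius).  Here, for
`2 ≠ 0` in `Ω`: `π ≫ ψ = [2]_{A∕A[2]}` (★ `mulNDesc_comp_quotientMk`) is ÉTALE (★ `etale_pow_id_left` on the ★ quotient abelian scheme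
`quotientBy`) and `ψ` is étale (★ `etale_quotientMk_left`), so `π` is étale by cancellation (Mathlib `Etale.of_comp`); `π` is injective on
`Ω`-points (G2's argument: `x₁² = x₂² ⇒ x₁ ∈ x₂·A[2]`) hence universally injective (★ `universallyInjective_of_injective`, any characteristic)
hence injective on all field-valued points (Mathlib `tfae_universallyInjective`, [StacksProject] 01S4), and surjective (range open since étale, all
`Ω`-points hit since `[2]` is onto); an étale, universally injective, surjective morphism is an isomorphism (★
`isIso_of_etale_of_forall_injective_of_surjective`, [SGA1] I 5.1).  The rest of the chain is characteristic-free (`2 ≠ 0` only) and is re-run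
verbatim.  CONCLUSIONS are printed with the conjuncts ∕ linear equivalences in the orientation opposite to the characteristic-`0` heads (same
content) so that both editions coexist in the tree.

* §1 **`exists_linEquiv_pullback_two_of_forall_twoTorsion_sameDivisor_of_two_ne_zero`** (G2 twin, `(h2 : (2 : Ω) ≠ 0)`): an effective divisor
  invariant as a divisor under the `A[2](Ω)`-translations is `[2]^*Θ₀` up to linear equivalence.
* §2 **`exists_forall_linEquiv_two_smul_of_isSection_of_two_ne_zero`** (G3 twin): the Néron–Severi half of a `2`-torsion-invariant class with an
  odd multiple carrying a section.
* §3 **`exists_isLambdaOfAt_isAmple_of_sq_of_two_ne_zero`** (G4 §5 twin; the O5 HEAD, binders in G4 §5's order `(hsurj2) (hamp) (hN) (hs₀) (hsec)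
  (h)`): `λ̄² = Λ(𝒪(Θ))` with `Θ` ample carrying a non-zero section of an odd multiple and `λ̄²` onto ⇒ `λ̄ = Λ(𝒪(Θ₁))` with `Θ₁` ample.

## References
* [MumfordAV1970] D. Mumford, *Abelian Varieties* (1970), §23 Thm. 3 (p. 231), §7 Thm. 4 (p. 72), §12 Thm. 1 (p. 112), §8 Thm. 1 (p. 77).
* [GortzWedhorn2023] U. Görtz, T. Wedhorn, *Algebraic Geometry II* (2023), Prop. 27.284 (p. 723), Prop. 27.187.
* [MumfordFogartyKirwan1994] D. Mumford, J. Fogarty, F. Kirwan, *Geometric Invariant Theory*, 3rd ed. (1994), Ch. 6 §2 Def. 6.3 (p. 120).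
* [SGA1] A. Grothendieck, *SGA 1*, Exp. I Thm. 5.1; Exp. V Prop. 2.6.
* [StacksProject] The Stacks Project, Tag 01S4, Tag 02GU.
-/

set_option autoImplicit false

noncomputable section

-- `(AbelianSchemeOver.ofAbelianVariety A).X` / `.Sections` agree with `A.X` / `𝟙_ ⟶ A.X` by `rfl` only (as in ★ G2).
set_option backward.isDefEq.respectTransparency false

universe u

open CategoryTheory CategoryTheory.Limits AlgebraicGeometry MonoidalCategory CartesianMonoidalCategory
open scoped MonObj

namespace Literature.AlgebraicGeometry.AbelianVarieties

open Literature.AlgebraicGeometry.Motives Literature.AlgebraicGeometry.AbelianSchemes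
  Literature.AlgebraicGeometry.RelativeSpec

variable {Ω : Type u} [Field Ω]

/-- Every `X ⟶ Spec Ω` over `Spec Ω` is THE structure map `toSpecOver X` (private copy of the tree's `eq_toSpecOver`).
[cite: GortzWedhorn2023, (27.35.2)] -/
private theorem eq_toSpecOver₂ {X : SchemeOver Ω} (g : X ⟶ specOver Ω Ω) : g = toSpecOver X := by
  ext : 1
  haveI : IsIso (specOver Ω Ω).hom := by
    change IsIso (Spec.map (CommRingCat.ofHom (algebraMap Ω Ω)))
    rw [Algebra.algebraMap_self, CommRingCat.ofHom_id, Spec.map_id]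
    infer_instance
  rw [← cancel_mono (specOver Ω Ω).hom, Over.w g, Over.w (toSpecOver X)]

/-- `N ≠ 0` in `K` ⇒ `N ≠ 0` in every residue field of a scheme over `Spec K` (the structure map `K → κ(s)` is a ring map out of a field).
[folklore] -/
private theorem natCast_residueField_ne_zero_of_ne_zero {K : Type u} [Field K] {S : Scheme.{u}} (f : S ⟶ Spec (.of K)) (s : S) {N : ℕ}
    (hN : (N : K) ≠ 0) : (N : S.residueField s) ≠ 0 := by
  let φ : K →+* S.residueField s := (Spec.preimage (S.fromSpecResidueField s ≫ f)).hom
  rw [← map_natCast φ N]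
  exact (map_ne_zero φ).mpr hN

/-! ## §1 An effective divisor invariant under the `2`-torsion translations descends through `[2]` (`2 ≠ 0`) -/

open CartierDivisor in
/-- **AN EFFECTIVE DIVISOR INVARIANT UNDER THE `2`-TORSION TRANSLATIONS IS `[2]^*Θ₀` up to linear equivalence — CHARACTERISTIC `≠ 2`**
([MumfordAV1970] §23 Thm. 3 (p. 231), `n = 2`, second half, over an algebraically closed field with `2 ≠ 0`).  For an effective Cartier divisor
`E` on the abelian variety `A` with `(t_x^*E).SameDivisor E` for every `x ∈ A[2](Ω)` there is `Θ₀` with `E.LinEquiv ([2]^*Θ₀)`.  Proof = ★ G2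
`exists_linEquiv_pullback_two_of_forall_twoTorsion_sameDivisor` verbatim (descend `E` along the free quotient `ψ : A → A∕A[2]`, ★
`CartierDivisor.exists_sameDivisor_pullback_of_isGeometricQuotient`; pull back along the inverse of `π : A∕A[2] ⥲ A`, `ψ ≫ π = [2]`) EXCEPT the
proof that `π` is an isomorphism: `π ≫ ψ = [2]_{A∕A[2]}` is étale and `ψ` is étale, so `π` is étale (Mathlib `Etale.of_comp`); injective on
`Ω`-points hence on all field-valued points (★ `universallyInjective_of_injective`, Mathlib `tfae_universallyInjective`); surjective; hence an
isomorphism (★ `isIso_of_etale_of_forall_injective_of_surjective`).  The `IsDominant` instance of `[2] = Hom.toSchemeHom ((2 : ℤ) • 𝟙 A)` is a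
binder (★ `AbelianVariety.isDominant_toSchemeHom_zsmul_of_ne_zero`). [cite: MumfordAV1970, §23 Thm. 3 (p. 231) and §7 Thm. 4 (p. 72)]
[cite: MumfordAV1970, §12 Thm. 1 (p. 112)] [cite: SGA1, Exp. I Thm. 5.1] [cite: StacksProject, Tag 01S4] -/
theorem _root_.Literature.AlgebraicGeometry.Motives.AbelianVariety.exists_linEquiv_pullback_two_of_forall_twoTorsion_sameDivisor_of_two_ne_zero
    [IsAlgClosed Ω] (h2 : (2 : Ω) ≠ 0) (A : AbelianVariety Ω) [IsDominant (AbelianVariety.Hom.toSchemeHom ((2 : ℤ) • 𝟙 A))]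
    (E : CartierDivisor A.X.left) (hE : E.IsEffective)
    (hinv : ∀ x ∈ A.torsionPoints Ω 2, (E.pullback (A.translation x).left).SameDivisor E) :
    ∃ Θ₀ : CartierDivisor A.X.left, E.LinEquiv (Θ₀.pullback (AbelianVariety.Hom.toSchemeHom ((2 : ℤ) • 𝟙 A))) := by
  classical
  -- `A` as an abelian scheme over `S = Spec Ω`, `u = 𝟙 : S → S`
  set 𝔄 := AbelianSchemeOver.ofAbelianVariety A with h𝔄
  haveI : IsCommMonObj 𝔄.X := A.instIsCommMonObj
  haveI : IsIntegral 𝔄.X.left := (inferInstance : IsIntegral A.X.left)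
  let u : Spec (.of Ω) ⟶ Spec (.of Ω) := 𝟙 _
  haveI : IsSeparated (𝔄.X.hom ≫ u) := by
    change IsSeparated (A.X.hom ≫ 𝟙 _); rw [Category.comp_id]; infer_instance
  haveI : LocallyOfFiniteType (𝔄.X.hom ≫ u) := by
    change LocallyOfFiniteType (A.X.hom ≫ 𝟙 _); rw [Category.comp_id]; infer_instance
  -- the `2`-torsion sections `K`
  let sec : A.Points Ω →* 𝔄.Sections :=
    { toFun := fun P => toSpecOver (𝟙_ (SchemeOver Ω)) ≫ P
      map_one' := MonObj.comp_one _
      map_mul' := fun P Q => MonObj.comp_mul _ _ _ }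
  let K : Subgroup 𝔄.Sections := (A.torsionPoints Ω 2).map sec
  haveI : Finite (A.torsionPoints Ω 2) := by
    apply Nat.finite_of_card_ne_zero
    rw [A.natCard_torsionPoints_eq_of_isAlgClosed Ω 2 (by exact_mod_cast h2)]
    exact pow_ne_zero _ (by decide)
  haveI : Finite K := by
    change Finite ((A.torsionPoints Ω 2).map sec : Set 𝔄.Sections)
    rw [Subgroup.coe_map]
    exact (Set.toFinite _).image _ |>.to_subtype
  have hK : ∀ σ : K, (σ : 𝔄.Sections) ^ 2 = 1 := by
    rintro ⟨σ, hσ⟩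
    obtain ⟨P, hP, rfl⟩ := Subgroup.mem_map.1 hσ
    change sec P ^ 2 = 1
    rw [← map_pow, ← zpow_ofNat, (AbelianVariety.mem_torsionPoints_iff 2 P).1 hP, map_one]
  have hfree : ∀ (Ω' : Type u) [Field Ω'] [IsAlgClosed Ω'] (x : Spec (.of Ω') ⟶ 𝔄.left) (σ : K), σ ≠ 1 →
      x ≫ (𝔄.translation (σ : 𝔄.Sections)).left ≠ x :=
    fun Ω' _ _ x σ hσ => comp_translation_left_ne_of_ne_one A K Ω' x σ hσ
  -- the quotient `ψ : A → A/K` and its ★ properties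
  have hqp : Literature.AlgebraicGeometry.HodgeTheory.IsQuasiProjectiveOver (Over.mk (𝔄.X.hom ≫ u) : SchemeOver Ω) := by
    have e : (Over.mk (𝔄.X.hom ≫ u) : SchemeOver Ω) = A.X := by
      change Over.mk (A.X.hom ≫ 𝟙 _) = A.X; rw [Category.comp_id]; rfl
    rw [e]
    exact Literature.AlgebraicGeometry.HodgeTheory.IsQuasiProjectiveOver.of_isProjectiveOver
      (AbelianVariety.isProjectiveOver_holds A)
  have hcov := 𝔄.translationActionOver_hcov_of_isQuasiProjectiveOver u K hqp
  have hG := 𝔄.exists_grpObj_isMonHom_quotientMk u K hcov hfree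
  have hsm : Smooth (𝔄.quotientOver u K).hom := 𝔄.smooth_quotientOver_hom_of_field K hcov
  have hgc := 𝔄.geometricallyConnected_quotientOver_hom u K hcov
  let B : AbelianSchemeOver (Spec (.of Ω)) := 𝔄.quotientBy u K hcov hG hsm hgc
  let ψ : 𝔄.X ⟶ 𝔄.quotientOver u K := 𝔄.quotientMk u K hcov
  let ρ := 𝔄.quotientActionOver u K hcov
  have hq : ρ.IsGeometricQuotient ψ.left := 𝔄.isGeometricQuotient_quotientActionOver u K hcov
  have hfreeCHR := 𝔄.quotientActionOver_free u K hcov hfree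
  haveI : Flat ψ.left := 𝔄.flat_quotientMk_left u K hcov hfree
  haveI : IsAffineHom ψ.left := 𝔄.isAffineHom_quotientMk_left u K hcov
  haveI : Surjective ψ.left := ⟨𝔄.quotientMk_left_surjective u K hcov⟩
  haveI : IsDominant ψ.left := ⟨(𝔄.quotientMk_left_surjective u K hcov).denseRange⟩
  haveI : IsIntegral (𝔄.quotientOver u K).left := (inferInstance : IsIntegral B.toAffine.toAbelianVariety.X.left)
  haveI : LocallyOfFiniteType (𝔄.quotientOver u K).hom := 𝔄.locallyOfFiniteType_quotientOver_hom u K hcov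
  -- `E` is invariant under the translations by the sections in `K`
  have hinv' : ∀ g : K, (E.pullback (ρ.aut g).hom).SameDivisor E := by
    rintro ⟨σ, hσ⟩
    obtain ⟨P, hP, rfl⟩ := Subgroup.mem_map.1 hσ
    have e : (ρ.aut ⟨sec P, hσ⟩).hom = (A.translation P).left := by
      rw [AbelianSchemeOver.quotientActionOver_aut_hom]
      exact congrArg CommaMorphism.left (translation_toSpecOver_comp A P)
    exact (E.pullback_congr_sameDivisor e).trans (hinv P hP)
  -- descend `E` along `ψ`
  obtain ⟨E₀, -, hE₀⟩ := E.exists_sameDivisor_pullback_of_isGeometricQuotient ρ hq hfreeCHR hE hinv'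
  -- `π : A/K → A` with `ψ ≫ π = [2]`
  let π : 𝔄.quotientOver u K ⟶ 𝔄.X := 𝔄.mulNDesc u K hK hcov
  have hψπ : ψ ≫ π = (𝟙 𝔄.X) ^ 2 := 𝔄.quotientMk_comp_mulNDesc u K hK hcov
  haveI : IsSeparated 𝔄.X.hom := (inferInstance : IsSeparated A.X.hom)
  haveI : LocallyOfFiniteType 𝔄.X.hom := (inferInstance : LocallyOfFiniteType A.X.hom)
  haveI : IsProper π.left := by
    haveI : IsProper (π.left ≫ 𝔄.X.hom) := by rw [Over.w π]; exact 𝔄.isProper_quotientOver_hom u K hcov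
    exact IsProper.of_comp π.left 𝔄.X.hom
  -- `π` is injective on `Ω`-points (`x₁² = x₂² ⇒ x₁ = t_σ x₂`, `σ ∈ K`, `t_σ ≫ ψ = ψ`) and `[2]` is onto on `Ω`-points
  have hsurjψ : Function.Surjective (AlgPoints.map (L := Ω) ψ) :=
    AlgPoints.map_surjective_of_surjective_of_isAlgClosed' (L := Ω) ψ
  have hψfib : ∀ x₁ x₂ : A.Points Ω, x₁ * x₂⁻¹ ∈ A.torsionPoints Ω 2 → AlgPoints.map ψ x₁ = AlgPoints.map ψ x₂ := by
    intro x₁ x₂ hx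
    have hmem : sec (x₁ * x₂⁻¹) ∈ K := Subgroup.mem_map_of_mem sec hx
    have h1 : toSpecOver (specOver Ω Ω) = 𝟙 _ := (eq_toSpecOver₂ (𝟙 (specOver Ω Ω))).symm
    have ht : AlgPoints.map (𝔄.translation (sec (x₁ * x₂⁻¹))) x₂ = x₁ := by
      have hc := AbelianSchemeOver.comp_translation 𝔄 x₂ (sec (x₁ * x₂⁻¹))
      rw [AlgPoints.map_apply]
      refine hc.trans ?_
      change (toUnit (specOver Ω Ω) ≫ toSpecOver (𝟙_ (SchemeOver Ω)) ≫ (x₁ * x₂⁻¹)) * x₂ = x₁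
      rw [toUnit_comp_toSpecOver_comp, h1, Category.id_comp, inv_mul_cancel_right]
    rw [← ht, ← AlgPoints.map_comp_apply]
    exact congrArg (fun φ => AlgPoints.map φ x₂) (𝔄.translation_comp_quotientMk u K hcov ⟨_, hmem⟩)
  have hinjΩ : Function.Injective (AlgPoints.map (L := Ω) π) := by
    intro q₁ q₂ h
    obtain ⟨x₁, rfl⟩ := hsurjψ q₁
    obtain ⟨x₂, rfl⟩ := hsurjψ q₂
    apply hψfib
    have hsq : ∀ x : A.Points Ω, AlgPoints.map π (AlgPoints.map ψ x) = x ^ 2 := fun x => by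
      rw [← AlgPoints.map_comp_apply, hψπ, AlgPoints.map_apply, MonObj.comp_pow, Category.comp_id]
    have h' : x₁ ^ 2 = x₂ ^ 2 := by rw [← hsq, ← hsq, h]
    rw [AbelianVariety.mem_torsionPoints_iff, zpow_ofNat, mul_pow, inv_pow, h', mul_inv_cancel]
  have hsurjΩ : Function.Surjective (AlgPoints.map (L := Ω) π) := by
    intro Q
    obtain ⟨R, hR⟩ := A.exists_pow_eq_of_isAlgClosed 2 (by exact_mod_cast h2) Q
    refine ⟨AlgPoints.map ψ R, ?_⟩
    rw [← AlgPoints.map_comp_apply, hψπ, AlgPoints.map_apply, MonObj.comp_pow, Category.comp_id, hR]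
  -- `π` IS AN ISOMORPHISM (`2 ≠ 0`): étale by cancellation against the étale `ψ`, universally injective, surjective
  haveI : IsIso π := by
    -- `π ≫ ψ = [2]_{A/K}` is étale
    haveI : Etale ψ.left := 𝔄.etale_quotientMk_left u K hcov hfree
    have hN : ∀ s : ↥(Spec (.of Ω)), ((2 : ℕ) : (Spec (.of Ω)).residueField s) ≠ 0 :=
      fun s => natCast_residueField_ne_zero_of_ne_zero (𝟙 _) s (by exact_mod_cast h2)
    have hπψ : π ≫ ψ = B.mulN 2 := 𝔄.mulNDesc_comp_quotientMk u K hK hcov hG hsm hgc hfree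
    haveI : Etale (π.left ≫ ψ.left) := by
      rw [← Over.comp_left, hπψ, AbelianSchemeOver.mulN_def]
      exact B.etale_pow_id_left hN
    haveI : Etale π.left := Etale.of_comp π.left ψ.left
    -- universally injective, hence injective on all field-valued points
    have hUI : UniversallyInjective π.left := universallyInjective_of_injective π hinjΩ
    have hinj : ∀ (F : Type u) [Field F], Function.Injective fun y : Spec (.of F) ⟶ (𝔄.quotientOver u K).left => y ≫ π.left :=
      ((tfae_universallyInjective π.left).out 0 1).mp hUI
    -- surjective: the range is open (étale) and contains every `Ω`-point
    haveI : Surjective π.left := surjective_of_isOpen_range_of_surjective_map π (π.left.isOpenMap.isOpen_range) hsurjΩ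
    haveI : IsIso π.left := ActionOver.IsGeometricQuotient.isIso_of_etale_of_forall_injective_of_surjective π.left hinj
    haveI : IsIso ((Over.forget (Spec (CommRingCat.of Ω))).map π) := ‹IsIso π.left›
    exact isIso_of_reflects_iso π (Over.forget _)
  -- `Θ₀ := (π⁻¹)^* E₀`
  refine ⟨E₀.pullback (inv π).left, ?_⟩
  have h2' : AbelianVariety.Hom.toSchemeHom ((2 : ℤ) • 𝟙 A) = (ψ ≫ π).left := by
    change ((2 : ℤ) • 𝟙 A).hom.hom.hom.left = _
    rw [AbelianVariety.hom_zsmul_id, hψπ, ← zpow_ofNat]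
    rfl
  haveI : IsDominant (ψ ≫ π).left := by rw [← h2']; infer_instance
  haveI : IsDominant ((ψ ≫ π).left ≫ (inv π).left) := inferInstance
  have hid : (ψ ≫ π).left ≫ (inv π).left = ψ.left := by
    rw [← Over.comp_left, Category.assoc, IsIso.hom_inv_id, Category.comp_id]
  exact (((E₀.pullback (inv π).left).pullback_congr_sameDivisor h2').trans
    (((E₀.pullback_pullback_sameDivisor (inv π).left (ψ ≫ π).left).trans (E₀.pullback_congr_sameDivisor hid)).trans
      hE₀)).linEquiv.symm

end Literature.AlgebraicGeometry.AbelianVarieties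

/-! ## §2 The Néron–Severi half, `2 ≠ 0` -/

namespace Literature.AlgebraicGeometry.Motives.AbelianVariety

open Literature.AlgebraicGeometry.AbelianVarieties

variable {Ω : Type u} [Field Ω] [IsAlgClosed Ω] (A : AbelianVariety Ω)

/-- **[MumfordAV1970] §23 Thm. 3 at `n = 2`, divisor form — the Néron–Severi HALF of a `2`-torsion-invariant class, CHARACTERISTIC `≠ 2`.**  Let `Θ`
be a Cartier divisor on the abelian variety `A` over the algebraically closed field `Ω` with `2 ≠ 0`, with `t_x^*Θ ∼ Θ` for every `x ∈ A(Ω)` with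
`x² = 1`, and suppose an odd multiple `N•Θ` carries a non-zero section `s₀`.  Then there is `Θ₁` with `Θ + 2•t_a^*Θ₁ ∼ t_a^*Θ + 2•Θ₁` for all
`a ∈ A(Ω)` (`Λ(Θ) = 2Λ(Θ₁)` pointwise).  Proof = ★ G3 `exists_forall_linEquiv_two_smul_of_isSection` verbatim with §1 for G2.
[cite: MumfordAV1970, §23 Thm. 3 (p. 231)] [cite: MumfordAV1970, §7 Thm. 4 (p. 72)] -/
theorem exists_forall_linEquiv_two_smul_of_isSection_of_two_ne_zero (h2 : (2 : Ω) ≠ 0) (Θ : CartierDivisor A.X.left)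
    (hK : ∀ x : A.Points Ω, x * x = 1 → (Θ.pullback (A.translation x).left).LinEquiv Θ)
    (N : ℕ) (s₀ : A.X.left.functionField) (hN : Odd N) (hs₀ : s₀ ≠ 0) (hsec : (N • Θ).IsSection s₀) :
    ∃ Θ₁ : CartierDivisor A.X.left, ∀ a : A.Points Ω,
      (Θ + 2 • (Θ₁.pullback (A.translation a).left)).LinEquiv ((Θ.pullback (A.translation a).left) + 2 • Θ₁) := by
  classical
  -- the finite set `T = A[2](Ω)`
  haveI : Finite (A.torsionPoints Ω 2) := by
    apply Nat.finite_of_card_ne_zero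
    rw [A.natCard_torsionPoints_eq_of_isAlgClosed Ω 2 (by exact_mod_cast h2)]
    exact pow_ne_zero _ (by decide)
  have hfin : (A.torsionPoints Ω 2 : Set (A.Points Ω)).Finite := Set.toFinite _
  let T : Finset (A.Points Ω) := hfin.toFinset
  have hTmem : ∀ x : A.Points Ω, x ∈ T ↔ x * x = 1 := fun x => by
    rw [Set.Finite.mem_toFinset, SetLike.mem_coe, mem_torsionPoints_iff, zpow_ofNat, pow_two]
  -- the theta-function divisor `E = 2N•Θ + div w ≥ 0`, invariant as a divisor under `A[2](Ω)` (★ G1)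
  have hsec2 : ((2 * N) • Θ).IsSection (s₀ ^ 2) := by
    rw [mul_comm]; exact CartierDivisor.IsSection.pow (D := Θ) hsec 2
  obtain ⟨w, hw, hwsec, hwinv⟩ := AbelianVarieties.AbelianVariety.exists_isSection_forall_sameDivisor_pullback_translation A Θ
    h2 T (fun x hx => (hTmem x).1 hx) (fun x hx => hK x ((hTmem x).1 hx)) (even_two_mul N) (pow_ne_zero 2 hs₀) hsec2
  have hE : ((2 * N) • Θ + CartierDivisor.principal w hw).IsEffective :=
    (CartierDivisor.isEffective_add_principal_iff hw).2 hwsec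
  have hinv : ∀ x ∈ A.torsionPoints Ω 2,
      (((2 * N) • Θ + CartierDivisor.principal w hw).pullback (A.translation x).left).SameDivisor
        ((2 * N) • Θ + CartierDivisor.principal w hw) := fun x hx =>
    hwinv x ((hTmem x).2 (by rwa [mem_torsionPoints_iff, zpow_ofNat, pow_two] at hx))
  -- descend through `[2]` (§1) and halve (★ G3)
  haveI : IsDominant (Hom.toSchemeHom ((2 : ℤ) • 𝟙 A)) := by
    have := A.isDominant_toSchemeHom_zsmul_of_ne_zero (N := 2) (by exact_mod_cast h2)
    rwa [Nat.cast_ofNat] at this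
  obtain ⟨Θ₀, hΘ₀⟩ := A.exists_linEquiv_pullback_two_of_forall_twoTorsion_sameDivisor_of_two_ne_zero h2 _ hE hinv
  have hlin : (Θ₀.pullback (Hom.toSchemeHom ((2 : ℤ) • 𝟙 A))).LinEquiv ((2 * N) • Θ) :=
    hΘ₀.symm.trans (CartierDivisor.LinEquiv.symm ⟨w, hw, CartierDivisor.SameDivisor.refl _⟩)
  obtain ⟨Θ₁, hΘ₁⟩ := A.exists_forall_linEquiv_two_smul h2 Θ Θ₀ hN hlin
  exact ⟨Θ₁, fun a => (hΘ₁ a).symm⟩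

end Literature.AlgebraicGeometry.Motives.AbelianVariety

/-! ## §3 The (V)-upgrade at a geometric point, `2 ≠ 0`: the O5 «HALF-`p`» head -/

namespace Literature.AlgebraicGeometry.AbelianSchemes

namespace AbelianSchemeOver

open Literature.AlgebraicGeometry.Motives Literature.AlgebraicGeometry.AbelianVarieties

variable {S : Scheme.{u}} (A : AbelianSchemeOver S) (D : A.DualPair) {Ω : Type u} [Field Ω] [IsAlgClosed Ω] (s : Spec (.of Ω) ⟶ S)

/-- **THE SQUARE ROOT OF `Λ` AT A GEOMETRIC POINT OF CHARACTERISTIC `≠ 2`** (O5 «HALF-`p`»; [MumfordAV1970] §23 Thm. 3, [GortzWedhorn2023]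
Prop. 27.284): `Ω` algebraically closed with `2 ≠ 0`; if `λ̄² = Λ(𝒪(Θ))` at `s` for an AMPLE `Θ` carrying a non-zero section of an odd multiple and
`λ̄²` is onto on `Ω`-points, then **`λ̄ = Λ(𝒪(Θ₁))` for an AMPLE `Θ₁`**.  Proof = ★ G4 §5 `exists_isAmple_isLambdaOfAt_of_sq` verbatim with §2 for
the Néron–Severi half: `A_s[2] ⊆ K(Θ)` (★ G4 §2), the half `Θ₁` (§2), `λ̄² = Λ(𝒪(2•Θ₁))` (★ `of_forall_weilDiv_linEquiv` + ★
`weilDiv_two_smul_linEquiv_of_half`), `λ̄ = Λ(𝒪(Θ₁))` (★ G4 §1 `of_sq_two_smul`), `Θ₁` ample (★ `isAmple_of_linEquiv_smul_add`).  Binders in ★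
G4 §5's order; conclusion with the conjuncts in the order `IsLambdaOfAt ∧ IsAmple`. [cite: MumfordAV1970, §23 Thm. 3 (p. 231)]
[cite: MumfordFogartyKirwan1994, Ch. 6 §2 Definition 6.3 (p. 120)] [cite: GortzWedhorn2023, Prop. 27.284 (p. 723)] -/
theorem exists_isLambdaOfAt_isAmple_of_sq_of_two_ne_zero (h2 : (2 : Ω) ≠ 0) {lam : A.X ⟶ D.hat.X} [IsMonHom lam]
    (hsurj2 : ∀ y : D.hat.FibrePoints s, ∃ x : A.FibrePoints s, x ≫ (lam ^ 2) = y)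
    {Θ : CartierDivisor (A.fibre s).toAbelianVariety.X.left} (hamp : Θ.IsAmple) {N : ℕ} (hN : Odd N)
    {s₀ : (A.fibre s).toAbelianVariety.X.left.functionField} (hs₀ : s₀ ≠ 0) (hsec : (N • Θ).IsSection s₀)
    (h : A.IsLambdaOfAt s D (lam ^ 2) Θ) :
    ∃ Θ₁ : CartierDivisor (A.fibre s).toAbelianVariety.X.left, A.IsLambdaOfAt s D lam Θ₁ ∧ Θ₁.IsAmple := by
  have hK : ∀ x : (A.fibre s).toAbelianVariety.Points Ω, x * x = 1 →
      (Θ.pullback ((A.fibre s).toAbelianVariety.translation x).left).LinEquiv Θ :=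
    fun x hx => IsLambdaOfAt.linEquiv_pullback_translation_of_sq A D s h hx
  -- the Néron–Severi half ([MumfordAV1970] §23 Thm. 3 at `n = 2`, `2 ≠ 0`)
  obtain ⟨Θ₁, hΘ₁'⟩ := (A.fibre s).toAbelianVariety.exists_forall_linEquiv_two_smul_of_isSection_of_two_ne_zero h2 Θ hK N s₀ hN hs₀ hsec
  have hΘ₁ : ∀ a : (A.fibre s).toAbelianVariety.Points Ω,
      ((Θ.pullback ((A.fibre s).toAbelianVariety.translation a).left) + 2 • Θ₁).LinEquiv
        (Θ + 2 • (Θ₁.pullback ((A.fibre s).toAbelianVariety.translation a).left)) := fun a => (hΘ₁' a).symm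
  have hsq : A.IsLambdaOfAt s D (lam ^ 2) (2 • Θ₁) :=
    IsLambdaOfAt.of_forall_weilDiv_linEquiv (h := h) (hlin := fun P => weilDiv_two_smul_linEquiv_of_half hΘ₁ P)
  have hN' : ∀ P : (A.fibre s).toAbelianVariety.Points Ω,
      ((Θ + -(2 • Θ₁)).pullback ((A.fibre s).toAbelianVariety.translation P).left).LinEquiv (Θ + -(2 • Θ₁)) :=
    fun P => IsLambdaOfAt.linEquiv_pullback_translation_sub h hsq P
  have hlin : Θ.LinEquiv (2 • Θ₁ + (Θ + -(2 • Θ₁))) := linEquiv_two_smul_add_sub Θ Θ₁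
  have hamp₁ : Θ₁.IsAmple := IsLambdaOfAt.isAmple_of_linEquiv_smul_add A D s (lam ^ 2) h hamp hsurj2 hN' two_pos hlin
  exact ⟨Θ₁, IsLambdaOfAt.of_sq_two_smul A D s h2 hsq, hamp₁⟩

end AbelianSchemeOver

end Literature.AlgebraicGeometry.AbelianSchemes

end
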